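/-
Copyright (c) 2026 the pub-hodgecm-mathlib formalisation cell (harness21).  Prover seat hodgecm-mathlib-K2E3-p11 (g6), Track B «K2-LIT» ∕ h413
(`stmt-HodgeConjecture-24833`), line `K2_E3_EllipticInputs`, road (11-3-split-nsc), leaf (nsc-S-C′) interior road (hInd) ∕ (HC-σ-Levi) (U12 ED. 22),
brick (HC-σ-BRIDGE, part 4 = the JOIN): the (HC-σ-Levi) statement ★ `exists_locallyIntegrable_smoothTrace_levi_of_gl2` AT K2E3-p24 (g0)'s INDUCING DATUM
`σ_M = (σ ∘ proj|_{M_c}) ⊗ δ^{1∕2}|_{M_c}` (bytes of ★ `K2E3ParabolicCharacterLeviUnipotentGL`), for `σ` irreducible admissible supercuspidal on the block Levi.  2026-09-04.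
-/
import Summits.HodgeConjecture.HodgeConjecture.Theorems.K2E3GL3LeviSupercuspidalCharLocInt        -- ★ p858825 (this seat): (HC-σ-Levi) `exists_locallyIntegrable_smoothTrace_levi_of_gl2`
import Summits.HodgeConjecture.HodgeConjecture.Theorems.K2E3ParabolicCharacterLeviUnipotentGL       -- ★ (K2E3-p24 g0): `exists_homeomorph_leviProjection_inclusion`, `isAdmissible_comp_inclusion_levi`, the datum `σ_M`
import Literature.NumberTheory.Automorphic.ParabolicInductionQuotientProofs                        -- ★ `IsSupercuspidal.twist`
import Literature.NumberTheory.Automorphic.SupercuspidalSubrep                                     -- ★ `IsSupercuspidal.comp_mulEquiv`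
import Literature.NumberTheory.Automorphic.ParabolicGLExactProofs                                  -- ★ `isOpen_ker_rootDeltaChar_standardParabolicGL`
import Literature.NumberTheory.Automorphic.MatrixCoefficientsSupercuspidalAdmissibleProofs              -- ★ `IsSupercuspidal.isAdmissible_of_sigmaCompactSpace` (§3)
import Literature.NumberTheory.Automorphic.PAdicRepsJacquetAdmissibilityProofs                       -- ★ `sigmaCompactSpace_levi` (§3)
import HarnessLib

/-!
# K2_E3 road (h413), leaf (nsc-S-C′), brick (HC-σ-BRIDGE, part 4) — the (HC-σ-Levi) input at the inducing datum `σ_M` of the (hInd) assembly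

Cell `pub/hodgecm-mathlib` (D-0151), Track B, seat K2E3-p11 (g6) = road owner of (11-3-split-nsc).  `--supports stmt-HodgeConjecture-24833 --as helper`; THEOREMS
ONLY (no definition ∕ instance ∕ notation ∕ named fact ∕ `sorry`); never imports `Cruxes/…/Lines`.  COUNT-NEUTRAL.  HYPOTHESIS-FIRST on the letter (S-C′-GL₂sc)
(road «GL₂-sc», K2E5-p17 (g5)), carried as the binder `hGL2` in the shape of ★ part 3.

THE JOIN.  K2E3-p24 (g0)'s «integrating out `U_c`» (★ `GLn.smoothTrace_twist_comp_leviProjection_eq_fibreIntegral`) hands the trace of the inducing datum on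
`P_c` to the representation
`σ_M := (σ ∘ (proj ∘ incl)) ⊗ (δ_{P_c}^{1∕2} ∘ incl)` of `M_c = ↥(standardLeviGL F c)`
(`proj = leviProjection F c`, `incl = Subgroup.inclusion (standardLeviGL_le F c)`), and the (hInd) assembly then needs the character of `σ_M` as ONE locally
integrable function on `M_c` — ★ part 3 gives it for every IRREDUCIBLE ADMISSIBLE SUPERCUSPIDAL representation of `M_c`.  This file checks the three adjectives
for `σ_M` from those of `σ` on the block Levi `Π_a GL_{n_a}(F)` (`proj ∘ incl` is an isomorphism of topological groups, ★ `exists_homeomorph_leviProjection_inclusion`;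
twisting by the smooth character `δ^{1∕2}|_{M_c}` preserves all three) and states (HC-σ-Levi) at `σ_M` VERBATIM in p24's bytes.

* §1 (any block labelling `c : n → α`): `surjective_leviProjection_comp_inclusion`, `isIrreducible_leviDatum`, `isOpen_ker_rootDeltaChar_comp_inclusion`,
  `isSupercuspidal_leviDatum` (admissibility is ★ p24 `isAdmissible_comp_inclusion_levi`, not restated).
* §2 (`c : Fin 3 → Fin 2` monotone surjective): **`exists_locallyIntegrable_smoothTrace_leviDatum_of_gl2`** — for `σ` irreducible admissible supercuspidal on
  `Π_a GL_{n_a}(F)` (`W : Type`) and every Haar `νM` on `M_c`: `∃ Θ, LocallyIntegrable Θ νM ∧ ∀ F ∈ SchwartzBruhat M_c, σ_M.smoothTrace νM F = ∫ F·Θ dνM`,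
  conditional on `hGL2` only.
* §3 **`leviCharacter_of_gl2`** — the same in the PRINTED binder shape of ★ F4's letter (hLevi) (σ irreducible SMOOTH supercuspidal, `V : Type` explicit in `hGL2`,
  test functions «locally constant + compact support»); admissibility of `σ` by ★ `IsSupercuspidal.isAdmissible_of_sigmaCompactSpace`.

HONEST LABEL: HC_CM is proved only modulo the 7 printed citations (2 remaining named inputs: hLiu418 = stmt-HodgeConjecture-24832, h413 =
stmt-HodgeConjecture-24833) until rung 0 closes; count-neutral helper; CONDITIONAL on the binder `hGL2` (OPEN: road «GL₂-sc»).

## References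
* [HarishChandra1970] Harish-Chandra (notes by G. van Dijk), *Harmonic Analysis on Reductive p-adic Groups*, LNM 162 (1970), Part I §3, Part III.
* [BushnellHenniart2006] C. J. Bushnell, G. Henniart, *The Local Langlands Conjecture for GL(2)* (2006), §9.1, §10.1.
* [BernsteinZelevinsky1977] I. N. Bernstein, A. V. Zelevinsky, *Induced representations of reductive 𝔭-adic groups I*, §1.8, §2.1, §2.3.
-/

set_option autoImplicit false
set_option linter.dupNamespace false

noncomputable section

open MeasureTheory MeasureTheory.Measure Topology TopologicalSpace Set
open scoped NNReal ENNReal MatrixGroups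

namespace Summit.HodgeConjecture.HodgeConjecture.Cruxes.H413.K2E3GL3LeviDatumSupercuspidalCharLocInt

open Literature.NumberTheory.Automorphic Representation
open Literature.NumberTheory.GaloisRepresentations Literature.NumberTheory.GaloisRepresentations.IsNonarchimedeanLocalField
open Summit.HodgeConjecture.HodgeConjecture.Cruxes.H413.K2E3ParabolicCharacterLeviUnipotentGL
open Summit.HodgeConjecture.HodgeConjecture.Cruxes.H413.K2E3GL3LeviSupercuspidalCharLocInt

/-! ## §1  The datum `σ_M` is irreducible and supercuspidal when `σ` is -/

section Datum

variable (F : Type*) [Field F] [ValuativeRel F] [TopologicalSpace F] [IsNonarchimedeanLocalField F]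
  {n : Type*} [Fintype n] [DecidableEq n] {α : Type*} [LinearOrder α] [Fintype α] (c : n → α)

/-- `proj ∘ incl : M_c → Π_a GL_{n_a}(F)` is surjective (it is a bijection, ★ `exists_homeomorph_leviProjection_inclusion`). [cite: BernsteinZelevinsky1977, §2.1] -/
theorem surjective_leviProjection_comp_inclusion :
    Function.Surjective ((leviProjection F c).comp (Subgroup.inclusion (standardLeviGL_le F c))) := by
  obtain ⟨e, he⟩ := exists_homeomorph_leviProjection_inclusion F c
  intro x
  refine ⟨e.symm x, ?_⟩
  rw [MonoidHom.comp_apply, ← he, Homeomorph.apply_symm_apply]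

omit [ValuativeRel F] [IsNonarchimedeanLocalField F] in
/-- The kernel of `δ_{P_c}^{1∕2}|_{M_c}` is open in `M_c` (★ `isOpen_ker_rootDeltaChar_standardParabolicGL`, continuity of `incl`). [cite: BernsteinZelevinsky1977, §1.8] -/
theorem isOpen_ker_rootDeltaChar_comp_inclusion [ValuativeRel F] [IsNonarchimedeanLocalField F] :
    IsOpen ((((rootDeltaChar (standardParabolicGL F c)).comp (Subgroup.inclusion (standardLeviGL_le F c))).ker :
      Set ↥(standardLeviGL F c))) := by
  haveI : IsTopologicalRing F := inferInstance
  have hic : Continuous (Subgroup.inclusion (standardLeviGL_le F c)) := continuous_induced_rng.2 continuous_subtype_val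
  exact (isOpen_ker_rootDeltaChar_standardParabolicGL F c).preimage hic

variable {W : Type*} [AddCommGroup W] [Module ℂ W]

/-- **`σ_M` is irreducible when `σ` is**: `proj ∘ incl` is surjective (★ `IsIrreducible.comp_of_surjective`) and a twist of an irreducible representation is
irreducible (★ `isIrreducible_twist`). [cite: BushnellHenniart2006, §9.1] [cite: BernsteinZelevinsky1977, §2.3] -/
theorem isIrreducible_leviDatum (σ : Representation ℂ (Π a, GL {i // c i = a} F) W) [σ.IsIrreducible] :
    (Representation.twist (σ.comp ((leviProjection F c).comp (Subgroup.inclusion (standardLeviGL_le F c))))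
      ((rootDeltaChar (standardParabolicGL F c)).comp (Subgroup.inclusion (standardLeviGL_le F c)))).IsIrreducible := by
  haveI : Representation.IsIrreducible (σ.comp ((leviProjection F c).comp (Subgroup.inclusion (standardLeviGL_le F c)))) :=
    ‹σ.IsIrreducible›.comp_of_surjective _ (surjective_leviProjection_comp_inclusion F c)
  exact isIrreducible_twist _ _

/-- **`σ_M` is supercuspidal when `σ` is** (matrix coefficients compactly supported modulo the centre): `proj ∘ incl : M_c ≃ Π_a GL_{n_a}(F)` is an open
isomorphism of topological groups (★ `exists_homeomorph_leviProjection_inclusion`, ★ `IsSupercuspidal.comp_mulEquiv`), and the twist by the smooth character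
`δ^{1∕2}|_{M_c}` keeps coefficients supported on the same set (★ `IsSupercuspidal.twist`). [cite: HarishChandra1970, Part I §3 p. 9] [cite: BushnellHenniart2006, §10.1] -/
theorem isSupercuspidal_leviDatum {σ : Representation ℂ (Π a, GL {i // c i = a} F) W} (hσ : σ.IsSupercuspidal) :
    (Representation.twist (σ.comp ((leviProjection F c).comp (Subgroup.inclusion (standardLeviGL_le F c))))
      ((rootDeltaChar (standardParabolicGL F c)).comp (Subgroup.inclusion (standardLeviGL_le F c)))).IsSupercuspidal := by
  haveI : IsTopologicalRing F := inferInstance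
  obtain ⟨e, he⟩ := exists_homeomorph_leviProjection_inclusion F c
  -- `proj ∘ incl` as an isomorphism of groups on the carrier of the homeomorphism `e`
  let em : ↥(standardLeviGL F c) ≃* (Π a, GL {i // c i = a} F) :=
    { toEquiv := e.toEquiv
      map_mul' := fun x y => by
        show e (x * y) = e x * e y
        rw [he, he, he, map_mul, map_mul] }
  have hem : ∀ m, em m = e m := fun _ => rfl
  have hopen : IsOpenMap em := by
    have : (em : ↥(standardLeviGL F c) → (Π a, GL {i // c i = a} F)) = e := funext hem
    rw [this]
    exact e.isOpenMap
  have hφ : em.toMonoidHom = (leviProjection F c).comp (Subgroup.inclusion (standardLeviGL_le F c)) :=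
    MonoidHom.ext fun m => by rw [MulEquiv.coe_toMonoidHom, hem, he, MonoidHom.comp_apply]
  have h1 : Representation.IsSupercuspidal (σ.comp ((leviProjection F c).comp (Subgroup.inclusion (standardLeviGL_le F c)))) := by
    rw [← hφ]
    exact hσ.comp_mulEquiv em hopen
  exact Representation.IsSupercuspidal.twist (h := h1) (hχ := isOpen_ker_rootDeltaChar_comp_inclusion F c)

end Datum

/-! ## §2  (HC-σ-Levi) at the datum: the character of `σ_M` is one locally integrable function on `M_c ⊂ GL₃(F)` -/

section Levi

variable {F : Type} [Field F] [ValuativeRel F] [TopologicalSpace F] [IsNonarchimedeanLocalField F]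
  [MeasurableSpace (GL (Fin 3) F)] [BorelSpace (GL (Fin 3) F)]

/-- **(HC-σ-Levi) AT THE INDUCING DATUM, HYPOTHESIS-FIRST ON THE `GL₂` LETTER.**  Let `c : Fin 3 → Fin 2` be monotone surjective, `σ` an irreducible admissible
supercuspidal representation of the block Levi `Π_a GL_{n_a}(F)` on `W : Type`, and `σ_M = (σ ∘ (proj ∘ incl)) ⊗ (δ_{P_c}^{1∕2} ∘ incl)` the representation of
`M_c = ↥(standardLeviGL F c)` it induces (K2E3-p24 (g0)'s bytes).  If every irreducible smooth admissible supercuspidal representation of `GL₂(F)` has a character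
that is an integrable function near every point (`hGL2` = the letter (S-C′-GL₂sc), any Borel structure and Haar measure on `GL₂(F)`), then for every Haar measure
`νM` on `M_c` the character of `σ_M` is ONE locally `νM`-integrable function:
`∃ Θ, LocallyIntegrable Θ νM ∧ ∀ F ∈ SchwartzBruhat M_c, tr σ_M(F dνM) = ∫ F Θ dνM` (★ part 3 at `σ_M`; §1 + ★ `isAdmissible_comp_inclusion_levi`).
[cite: HarishChandra1970, Part III] [cite: BushnellHenniart2006, §9.1] [cite: BernsteinZelevinsky1977, §2.1, §2.3] -/
theorem exists_locallyIntegrable_smoothTrace_leviDatum_of_gl2 (c : Fin 3 → Fin 2) (hc : Monotone c) (hcs : Function.Surjective c)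
    (hGL2 : ∀ [MeasurableSpace (GL (Fin 2) F)] [BorelSpace (GL (Fin 2) F)] (μ₂ : Measure (GL (Fin 2) F)) [μ₂.IsHaarMeasure]
      {V : Type} [AddCommGroup V] [Module ℂ V] (ρ : Representation ℂ (GL (Fin 2) F) V) [ρ.IsIrreducible],
      ρ.IsSmooth → ρ.IsAdmissible → ρ.IsSupercuspidal →
      ∀ g : GL (Fin 2) F, ∃ U : Set (GL (Fin 2) F), IsOpen U ∧ g ∈ U ∧ ∃ Θ : GL (Fin 2) F → ℂ, IntegrableOn Θ U μ₂ ∧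
        ∀ f : GL (Fin 2) F → ℂ, f ∈ SchwartzBruhat (GL (Fin 2) F) → tsupport f ⊆ U → ρ.smoothTrace μ₂ f = ∫ x, f x * Θ x ∂μ₂)
    {W : Type} [AddCommGroup W] [Module ℂ W] (σ : Representation ℂ (Π a, GL {i : Fin 3 // c i = a} F) W) [σ.IsIrreducible]
    (hσa : σ.IsAdmissible) (hσsc : σ.IsSupercuspidal)
    (νM : Measure ↥(standardLeviGL F c)) [νM.IsHaarMeasure] :
    ∃ Θ : ↥(standardLeviGL F c) → ℂ, LocallyIntegrable Θ νM ∧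
      ∀ Fn : ↥(standardLeviGL F c) → ℂ, Fn ∈ SchwartzBruhat ↥(standardLeviGL F c) →
        (Representation.twist (σ.comp ((leviProjection F c).comp (Subgroup.inclusion (standardLeviGL_le F c))))
            ((rootDeltaChar (standardParabolicGL F c)).comp (Subgroup.inclusion (standardLeviGL_le F c)))).smoothTrace νM Fn =
          ∫ m, Fn m * Θ m ∂νM := by
  haveI := isIrreducible_leviDatum F c σ
  exact exists_locallyIntegrable_smoothTrace_levi_of_gl2 c hc hcs hGL2 _ (isAdmissible_comp_inclusion_levi F c hσa)
    (isSupercuspidal_leviDatum F c hσsc) νM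

end Levi

/-! ## §3  The letter (hLevi) of ★ F4 `K2E3GL3TwoBlockCuspidalSupportCharLocIntOfLevi` in its PRINTED binder shape (K2E3-p24 (g0) 09:09:27Z; = the type of
the v0 probe `probe_leviCharacter_of_gl2` of `tie_SCprime.cand.v0` minus `[CharZero F]`) -/

section Letter

/-- **(S-C′-GL₂sc) ⟹ (hLevi), PRINTED SHAPE.**  For `σ` irreducible SMOOTH supercuspidal on the block Levi (admissibility is automatic: ★
`IsSupercuspidal.isAdmissible_of_sigmaCompactSpace`, ★ `sigmaCompactSpace_levi`), the GL₂ letter with `V : Type` explicit, and test functions given as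
«locally constant + compact support»: the character of `σ_M` is one locally integrable function (§2).  F4 ∕ the (nsc-S-C′) tie consume it by
`fun W _ _ σ hσi hσs hσc νM _ => leviCharacter_of_gl2 F hGL2 c hc hcs W σ hσi hσs hσc νM`. [cite: HarishChandra1970, Part III] [cite: BernsteinZelevinsky1977, §2.3, §3] -/
theorem leviCharacter_of_gl2 (F : Type) [Field F] [ValuativeRel F] [TopologicalSpace F] [IsNonarchimedeanLocalField F]
    (hGL2 : ∀ [MeasurableSpace (GL (Fin 2) F)] [BorelSpace (GL (Fin 2) F)] (μ : Measure (GL (Fin 2) F)) [μ.IsHaarMeasure]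
      (V : Type) [AddCommGroup V] [Module ℂ V] (ρ : Representation ℂ (GL (Fin 2) F) V) [ρ.IsIrreducible],
      ρ.IsSmooth → ρ.IsAdmissible → ρ.IsSupercuspidal → ∀ g : GL (Fin 2) F,
        ∃ U : Set (GL (Fin 2) F), IsOpen U ∧ g ∈ U ∧ ∃ Θ : GL (Fin 2) F → ℂ, IntegrableOn Θ U μ ∧
          ∀ f : GL (Fin 2) F → ℂ, f ∈ SchwartzBruhat (GL (Fin 2) F) → tsupport f ⊆ U → ρ.smoothTrace μ f = ∫ x, f x * Θ x ∂μ)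
    [MeasurableSpace (GL (Fin 3) F)] [BorelSpace (GL (Fin 3) F)]
    (c : Fin 3 → Fin 2) (hc : Monotone c) (hcs : Function.Surjective c)
    (W : Type) [AddCommGroup W] [Module ℂ W] (σ : Representation ℂ (Π a, GL {i // c i = a} F) W)
    (hσi : σ.IsIrreducible) (hσs : σ.IsSmooth) (hσc : σ.IsSupercuspidal)
    (νM : Measure ↥(standardLeviGL F c)) [νM.IsHaarMeasure] :
    ∃ Θ : ↥(standardLeviGL F c) → ℂ, LocallyIntegrable Θ νM ∧
      ∀ φ : ↥(standardLeviGL F c) → ℂ, IsLocallyConstant φ → HasCompactSupport φ →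
        (Representation.twist (σ.comp ((leviProjection F c).comp (Subgroup.inclusion (standardLeviGL_le F c))))
            ((rootDeltaChar (standardParabolicGL F c)).comp (Subgroup.inclusion (standardLeviGL_le F c)))).smoothTrace νM φ =
          ∫ m, φ m * Θ m ∂νM := by
  haveI := hσi
  haveI : SigmaCompactSpace (Π a, GL {i // c i = a} F) := sigmaCompactSpace_levi F c
  have hadm : σ.IsAdmissible := IsSupercuspidal.isAdmissible_of_sigmaCompactSpace hσs hσc
  obtain ⟨Θ, hΘ, h⟩ := exists_locallyIntegrable_smoothTrace_leviDatum_of_gl2 c hc hcs (fun μ _ V _ _ ρ _ => hGL2 μ V ρ) σ hadm hσc νM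
  exact ⟨Θ, hΘ, fun φ hlc hcpt => h φ ⟨hlc, hcpt⟩⟩

end Letter

end Summit.HodgeConjecture.HodgeConjecture.Cruxes.H413.K2E3GL3LeviDatumSupercuspidalCharLocInt

end
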